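import Mathlib
import HarnessLib
import Summits.HubbardSuperconductivity.HubbardSuperconductivity.Theorems.KLProgrammeC4aTadpoleJetAssembly

/-!
# Route `KLProgramme` — crux C4a, (L3) the Bell dominators of a RIGID path against INVERSE-POWER majorants are SCALE-FREE:
# `Mb_k ≤ Cb/m^k`, `Ds_i ≤ x·m` (`i ≤ 3`) ⟹ `bell4 Mb Ds j ≤ Cb·P_j(x)` (`j ≤ 3`), and at `j = 4` up to the single non-rigid monomial `Mb 1·Ds 4`

Cell `gate-hubbard-kl`, lane hubbard-kl-c4a-1 (g5); helper for stub (C) `stub_twoLeg_curvature` of the engine-flow child `KLRegimeEngineV17F2`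
(stmt-HubbardSuperconductivity-20437); memo HOME/hubbard-kl-c4a-1/C4A-PLAN.md §22.5–22.6.  The three (L3) geometry files give, at chart point `(ρ,ϑ)` with
`δ = |ρ| + |ϑ − π|`: `‖S(0)‖ ≥ c·δ` (`…C4aPathComparability`), `‖∂ⁱS(0)‖ ≤ L·δ` for `i ≤ 3` (`…C4aPathRigidity` + radial rows), and the analytic input of
(L3) proper is an inverse-power majorant of the scale-resolved bubble, `‖DᵏB(S(0))‖ ≤ Cb·max(c·δ, Λ)^{−k}`.  With `m := max(c·δ, Λ)` and `x := L/c` every Bell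
monomial `Mb_k·Ds_{i₁}⋯Ds_{i_k}` (`k` factors) is `≤ Cb·x^k` — the chart distance CANCELS, the `ϑ`-integral of the dominator is trivially finite and free of
the scale `Λ`: FST II's inner co-moving volume gain in the form the bridge `coMovingJetsL1_pairSum` consumes.

* §1 `mul_max_le` (`L·δ ≤ (L/c)·max(c·δ, Λ)`), `monomial_le` (`Mb_k·Π Ds ≤ Cb·x^k`);
* §2 **`bell4_le_of_rigid`**: `bell4 Mb Ds 1 ≤ Cb·x`, `bell4 Mb Ds 2 ≤ Cb·(x² + x)`, `bell4 Mb Ds 3 ≤ Cb·(x³ + 3x² + x)`,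
  `bell4 Mb Ds 4 ≤ Cb·(x⁴ + 6x³ + 7x²) + Mb 1·Ds 4` (the order-4 path jet has no rigidity bound in the tree — its monomial is kept by name; it is
  `≤ (Cb/m)·Ds 4`, a logarithm after the `ϑ`-integral, far inside the order-4 budget).

Elementary real inequalities; nothing about the Hubbard model; nothing asserts superconductivity.
References: FST II CPAM 51 (1998) §3 Thm 3.5; BGM 2006 §2.4 (2.40) [cite: BenfattoGiulianiMastropietro2006].
-/

noncomputable section

namespace Summit.HubbardSuperconductivity.HubbardSuperconductivity.Theorems.C4a

set_option linter.dupNamespace false -- summit = problem name (single-conjunct summit), D-0017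

open Real

/-! ## §1 One monomial -/

/-- `L·δ ≤ (L/c)·max(c·δ, Λ)` for `0 < c`, `0 ≤ L`. -/
theorem mul_max_le {c L δ Λ : ℝ} (hc : 0 < c) (hL : 0 ≤ L) : L * δ ≤ L / c * max (c * δ) Λ := by
  have h : L * δ = L / c * (c * δ) := by field_simp
  rw [h]
  exact mul_le_mul_of_nonneg_left (le_max_left _ _) (div_nonneg hL hc.le)

/-- **One Bell monomial**: `0 ≤ Mb ≤ Cb/m^k` and `0 ≤ Dᵢ ≤ x·m` for the `k` factors ⟹ `Mb·D₁⋯D_k ≤ Cb·x^k` — here for the shapes that occur in `bell4`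
(`k` equal factors, and the mixed products of orders 3 and 4). -/
theorem monomial_le {Mb D m x Cb : ℝ} {k : ℕ} (hm : 0 < m) (hMb0 : 0 ≤ Mb) (hMb : Mb ≤ Cb / m ^ k) (hD0 : 0 ≤ D) (hD : D ≤ x * m) :
    Mb * D ^ k ≤ Cb * x ^ k := by
  have hx : 0 ≤ x := by
    by_contra h
    push Not at h
    have : x * m < 0 := mul_neg_of_neg_of_pos h hm
    linarith
  have hDk : D ^ k ≤ (x * m) ^ k := pow_le_pow_left₀ hD0 hD k
  have hmk : 0 < m ^ k := pow_pos hm k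
  calc Mb * D ^ k ≤ Cb / m ^ k * (x * m) ^ k :=
        mul_le_mul hMb hDk (pow_nonneg hD0 k) ((le_trans hMb0 hMb))
    _ = Cb * x ^ k := by rw [mul_pow]; field_simp

/-- Mixed monomial with two distinct factors: `Mb ≤ Cb/m^(a+b)`, `D ≤ x m`, `D' ≤ x m` ⟹ `Mb·D^a·D'^b ≤ Cb·x^(a+b)`. -/
theorem monomial_le₂ {Mb D D' m x Cb : ℝ} {a b : ℕ} (hm : 0 < m) (hMb0 : 0 ≤ Mb) (hMb : Mb ≤ Cb / m ^ (a + b)) (hD0 : 0 ≤ D)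
    (hD : D ≤ x * m) (hD0' : 0 ≤ D') (hD' : D' ≤ x * m) : Mb * D ^ a * D' ^ b ≤ Cb * x ^ (a + b) := by
  have hx : 0 ≤ x := by
    by_contra h
    push Not at h
    have : x * m < 0 := mul_neg_of_neg_of_pos h hm
    linarith
  have hDa : D ^ a ≤ (x * m) ^ a := pow_le_pow_left₀ hD0 hD a
  have hDb : D' ^ b ≤ (x * m) ^ b := pow_le_pow_left₀ hD0' hD' b
  have hmk : 0 < m ^ (a + b) := pow_pos hm _
  have hprod : D ^ a * D' ^ b ≤ (x * m) ^ (a + b) := by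
    rw [pow_add]; exact mul_le_mul hDa hDb (pow_nonneg hD0' b) (pow_nonneg (mul_nonneg hx hm.le) a)
  calc Mb * D ^ a * D' ^ b = Mb * (D ^ a * D' ^ b) := by ring
    _ ≤ Cb / m ^ (a + b) * (x * m) ^ (a + b) := mul_le_mul hMb hprod (mul_nonneg (pow_nonneg hD0 a) (pow_nonneg hD0' b)) (le_trans hMb0 hMb)
    _ = Cb * x ^ (a + b) := by rw [mul_pow]; field_simp

/-! ## §2 The four Bell dominators -/

/-- **Bell dominators of a rigid path against inverse-power majorants are scale-free.**  For `0 < m`, `0 ≤ Mb k ≤ Cb/m^k` (`1 ≤ k ≤ 4`),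
`0 ≤ Ds i ≤ x·m` (`1 ≤ i ≤ 3`) and `0 ≤ Ds 4`:
`bell4 Mb Ds 1 ≤ Cb·x`, `bell4 Mb Ds 2 ≤ Cb·(x² + x)`, `bell4 Mb Ds 3 ≤ Cb·(x³ + 3x² + x)`, `bell4 Mb Ds 4 ≤ Cb·(x⁴ + 6x³ + 7x²) + Mb 1·Ds 4`.
[cite: BenfattoGiulianiMastropietro2006, §2.4 (2.40)] -/
theorem bell4_le_of_rigid {Mb Ds : ℕ → ℝ} {m x Cb : ℝ} (hm : 0 < m) (hMb0 : ∀ k, 1 ≤ k → k ≤ 4 → 0 ≤ Mb k)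
    (hMb : ∀ k, 1 ≤ k → k ≤ 4 → Mb k ≤ Cb / m ^ k) (hDs0 : ∀ i, 1 ≤ i → i ≤ 4 → 0 ≤ Ds i)
    (hDs : ∀ i, 1 ≤ i → i ≤ 3 → Ds i ≤ x * m) :
    bell4 Mb Ds 1 ≤ Cb * x ∧ bell4 Mb Ds 2 ≤ Cb * (x ^ 2 + x) ∧ bell4 Mb Ds 3 ≤ Cb * (x ^ 3 + 3 * x ^ 2 + x) ∧
      bell4 Mb Ds 4 ≤ Cb * (x ^ 4 + 6 * x ^ 3 + 7 * x ^ 2) + Mb 1 * Ds 4 := by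
  have n1 := hMb0 1 le_rfl (by norm_num); have n2 := hMb0 2 (by norm_num) (by norm_num)
  have n3 := hMb0 3 (by norm_num) (by norm_num); have n4 := hMb0 4 (by norm_num) le_rfl
  have b1 := hMb 1 le_rfl (by norm_num); have b2 := hMb 2 (by norm_num) (by norm_num)
  have b3 := hMb 3 (by norm_num) (by norm_num); have b4 := hMb 4 (by norm_num) le_rfl
  have d1 := hDs0 1 le_rfl (by norm_num); have d2 := hDs0 2 (by norm_num) (by norm_num)
  have d3 := hDs0 3 (by norm_num) (by norm_num)
  have e1 := hDs 1 le_rfl (by norm_num); have e2 := hDs 2 (by norm_num) (by norm_num); have e3 := hDs 3 (by norm_num) le_rfl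
  -- the monomials
  have m11 : Mb 1 * Ds 1 ≤ Cb * x := by
    have h := monomial_le (k := 1) hm n1 (by simpa using b1) d1 e1; simpa using h
  have m12 : Mb 1 * Ds 2 ≤ Cb * x := by
    have h := monomial_le (k := 1) hm n1 (by simpa using b1) d2 e2; simpa using h
  have m13 : Mb 1 * Ds 3 ≤ Cb * x := by
    have h := monomial_le (k := 1) hm n1 (by simpa using b1) d3 e3; simpa using h
  have m21 : Mb 2 * Ds 1 ^ 2 ≤ Cb * x ^ 2 := monomial_le hm n2 b2 d1 e1
  have m22 : Mb 2 * Ds 2 ^ 2 ≤ Cb * x ^ 2 := monomial_le hm n2 b2 d2 e2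
  have m2m : Mb 2 * Ds 1 ^ 1 * Ds 2 ^ 1 ≤ Cb * x ^ (1 + 1) := monomial_le₂ hm n2 (by simpa using b2) d1 e1 d2 e2
  have m2m' : Mb 2 * Ds 1 ^ 1 * Ds 3 ^ 1 ≤ Cb * x ^ (1 + 1) := monomial_le₂ hm n2 (by simpa using b2) d1 e1 d3 e3
  have m31 : Mb 3 * Ds 1 ^ 3 ≤ Cb * x ^ 3 := monomial_le hm n3 b3 d1 e1
  have m3m : Mb 3 * Ds 1 ^ 2 * Ds 2 ^ 1 ≤ Cb * x ^ (2 + 1) := monomial_le₂ hm n3 (by simpa using b3) d1 e1 d2 e2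
  have m41 : Mb 4 * Ds 1 ^ 4 ≤ Cb * x ^ 4 := monomial_le hm n4 b4 d1 e1
  simp only [pow_one] at m2m m2m' m3m
  norm_num at m2m m2m' m3m
  refine ⟨?_, ?_, ?_, ?_⟩
  · simp only [bell4]; exact m11
  · simp only [bell4]; linarith
  · simp only [bell4]; nlinarith
  · simp only [bell4]; nlinarith

end Summit.HubbardSuperconductivity.HubbardSuperconductivity.Theorems.C4a

end
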